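import Summits.Ventures.HSemireg.WedgeHankelRecurrenceGaussElectrostaticSumRules

/-!
# Venture HSemireg — **HIGHER MOMENTS OF THE CLASSICAL ZEROS FROM STIELTJES' EQUILIBRIA**: the pair symmetrizations `Σ_k Σ_{j≠k} x_k²∕(x_k − x_j) = t·S₁` and
# `Σ_k Σ_{j≠k} x_k³∕(x_k − x_j) = ((2t−1) S₂ + S₁²)∕2` (`S_p = Σ x_k^p`, `t + 1` distinct points) turn the equilibrium identities into moment recursions: HERMITE (`S_k = x_k∕2`): **`Σ x_k⁴ = t(t+1)(2t−1)`**
# for the zeros of `He_{t+1}`; LAGUERRE (`2x_k S_k = x_k − α − 1`): `S₂ = (2t+1+α) S₁` (recovering N394) and **`S₃ = (2t+α) S₂ + S₁²`**, `S₁ = (t+1)(t+1+α)`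

HONEST FRAMING. Part of the Lean index of the computation cell `pub-hsemireg` (seat p10 gen 46, Sunday typer «UNIFORM-IN-n»).  Finite double sums only; no variety, no cohomology theory, no sheaf, no Ext
group and no semiregularity map is constructed here; nothing here says that HC / HC_CM / HC_AV holds; no Literature fact (unproved `Prop`) is declared or used.  Custodian versions as in
`WedgeHankelSiegelIdeal` (1/3).
SOURCES (cited).  G. Szegő, *Orthogonal Polynomials*, §6.7 and Problems; S. Ahmed, M. Bruschi, F. Calogero, M. A. Olshanetsky, A. M. Perelomov, Nuovo Cimento B 49 (1979) 173–199 (moments of the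
zeros of Hermite ∕ Laguerre polynomials); K. M. Case, J. Math. Phys. 21 (1980) 702–708.
PROOF TYPED HERE.  `x_k^p∕(x_k − x_j) + x_j^p∕(x_j − x_k) = (x_k^p − x_j^p)∕(x_k − x_j)`: for `p = 2` the pair sum is `x_k + x_j`, for `p = 3` it is `x_k² + x_k x_j + x_j²`; summing over ordered pairs
(N398 `sum_sum_erase_antisymm` for the antisymmetric remainder); then N388 ∕ N389.
DEDUP DISCLOSURE (`rg -n -i 'fourth_moment|third_moment|sum_sum_erase_sq' Summits/Ventures/HSemireg`, 2026-09-03): N394 (second moments), N398 (reciprocal sum rules).  The 4 names below: 0 hits tree-wide.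

WHAT IS IN THE TREE.  N398 `sum_sum_erase_antisymm`; N388 `hermite_zeros_electrostatic`; N389 `laguerre_zeros_electrostatic`; N359 `hermite_zeros` (`Σ x = 0`, `Σ x² = t(t+1)`); N376 (`S₁` for Laguerre).
THIS FILE (namespace `Summit.Ventures.HSemireg.Wedge.HankelOuter` continued; CHAINED on N398 (import only); 0 definitions):
* §1164 `sum_sum_erase_sq_mul_inv_sub` (`= t S₁`), `sum_sum_erase_cube_mul_inv_sub` (`= ((2t−1)S₂ + S₁²)∕2`), **`hermite_zeros_fourth_moment`** (`Σ x_k⁴ = t(t+1)(2t−1)`),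
  **`laguerre_zeros_third_moment`** (`Σ x_k³ = (2t+α) Σ x_k² + (Σ x_k)²`).
CAVEATS.  The zeros enter through the hypotheses of N388 ∕ N389.  Nothing Ext-side.  New names only.
-/

open Module Polynomial
open scoped Matrix Polynomial

namespace Summit.Ventures.HSemireg.Wedge.HankelOuter

/-! ## §1164. Moment recursions from the equilibrium identities -/

/-- **`Σ_k Σ_{j ≠ k} x_k²∕(x_k − x_j) = t · Σ_k x_k`** for distinct `x_0, …, x_t`. [pair symmetrization; this file, §1164] -/
theorem sum_sum_erase_sq_mul_inv_sub {t : ℕ} {x : Fin (t + 1) → ℝ} (hx : Function.Injective x) :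
    ∑ k, ∑ j ∈ Finset.univ.erase k, x k ^ 2 * (x k - x j)⁻¹ = (t : ℝ) * ∑ k, x k := by
  -- `x_k²/(x_k − x_j) = ½ (x_k + x_j) + ½ (x_k² + x_j²)... ` precisely: `= (x_k + x_j)/2 + (x_k² + x_j²)/(2(x_k − x_j))`, the second kernel antisymmetric
  have hsplit : ∀ k, ∀ j ∈ Finset.univ.erase k, x k ^ 2 * (x k - x j)⁻¹ = (x k + x j) / 2 + (x k ^ 2 + x j ^ 2) / (2 * (x k - x j)) := fun k j hj => by
    have hne : x k - x j ≠ 0 := sub_ne_zero.2 fun h => (Finset.mem_erase.1 hj).1 (hx h).symm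
    field_simp; ring
  have hanti := sum_sum_erase_antisymm (fun k j : Fin (t + 1) => (x k ^ 2 + x j ^ 2) / (2 * (x k - x j))) fun k j => by
    show (x k ^ 2 + x j ^ 2) / (2 * (x k - x j)) = -((x j ^ 2 + x k ^ 2) / (2 * (x j - x k)))
    rw [← div_neg, show -(2 * (x j - x k)) = 2 * (x k - x j) by ring, add_comm]
  have hcard : ∀ k : Fin (t + 1), (Finset.univ.erase k).card = t := fun k => by
    rw [Finset.card_erase_of_mem (Finset.mem_univ _), Finset.card_univ, Fintype.card_fin, Nat.add_sub_cancel]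
  -- `Σ_{j ≠ k} (x_k + x_j)/2 = (t x_k + (S₁ − x_k))/2`
  have hlin : ∀ k : Fin (t + 1), ∑ j ∈ Finset.univ.erase k, (x k + x j) / 2 = ((t : ℝ) * x k + (∑ j, x j - x k)) / 2 := fun k => by
    rw [← Finset.sum_div, Finset.sum_add_distrib, Finset.sum_const, hcard, nsmul_eq_mul, Finset.sum_erase_eq_sub (Finset.mem_univ k)]
  calc ∑ k, ∑ j ∈ Finset.univ.erase k, x k ^ 2 * (x k - x j)⁻¹
      = ∑ k, ∑ j ∈ Finset.univ.erase k, ((x k + x j) / 2 + (x k ^ 2 + x j ^ 2) / (2 * (x k - x j))) := Finset.sum_congr rfl fun k _ => Finset.sum_congr rfl (hsplit k)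
    _ = ∑ k : Fin (t + 1), (((t : ℝ) * x k + (∑ j, x j - x k)) / 2 + ∑ j ∈ Finset.univ.erase k, (x k ^ 2 + x j ^ 2) / (2 * (x k - x j))) :=
        Finset.sum_congr rfl fun k _ => by rw [Finset.sum_add_distrib, hlin]
    _ = (t : ℝ) * ∑ k, x k := by
        rw [Finset.sum_add_distrib, hanti, add_zero, ← Finset.sum_div, Finset.sum_add_distrib, Finset.sum_sub_distrib, Finset.sum_const, Finset.card_univ, Fintype.card_fin,
          nsmul_eq_mul, ← Finset.mul_sum]
        push_cast; ring

/-- **`Σ_k Σ_{j ≠ k} x_k³∕(x_k − x_j) = ((2t − 1) Σ x_k² + (Σ x_k)²)∕2`** for distinct `x_0, …, x_t`. [pair symmetrization; this file, §1164] -/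
theorem sum_sum_erase_cube_mul_inv_sub {t : ℕ} {x : Fin (t + 1) → ℝ} (hx : Function.Injective x) :
    ∑ k, ∑ j ∈ Finset.univ.erase k, x k ^ 3 * (x k - x j)⁻¹ = ((2 * (t : ℝ) - 1) * ∑ k, x k ^ 2 + (∑ k, x k) ^ 2) / 2 := by
  have hsplit : ∀ k, ∀ j ∈ Finset.univ.erase k, x k ^ 3 * (x k - x j)⁻¹ = (x k ^ 2 + x k * x j + x j ^ 2) / 2 + (x k ^ 3 + x j ^ 3) / (2 * (x k - x j)) := fun k j hj => by
    have hne : x k - x j ≠ 0 := sub_ne_zero.2 fun h => (Finset.mem_erase.1 hj).1 (hx h).symm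
    field_simp; ring
  have hanti := sum_sum_erase_antisymm (fun k j : Fin (t + 1) => (x k ^ 3 + x j ^ 3) / (2 * (x k - x j))) fun k j => by
    show (x k ^ 3 + x j ^ 3) / (2 * (x k - x j)) = -((x j ^ 3 + x k ^ 3) / (2 * (x j - x k)))
    rw [← div_neg, show -(2 * (x j - x k)) = 2 * (x k - x j) by ring, add_comm]
  have hcard : ∀ k : Fin (t + 1), (Finset.univ.erase k).card = t := fun k => by
    rw [Finset.card_erase_of_mem (Finset.mem_univ _), Finset.card_univ, Fintype.card_fin, Nat.add_sub_cancel]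
  have hlin : ∀ k : Fin (t + 1), ∑ j ∈ Finset.univ.erase k, (x k ^ 2 + x k * x j + x j ^ 2) / 2 =
      ((t : ℝ) * x k ^ 2 + x k * (∑ j, x j - x k) + (∑ j, x j ^ 2 - x k ^ 2)) / 2 := fun k => by
    rw [← Finset.sum_div, Finset.sum_add_distrib, Finset.sum_add_distrib, Finset.sum_const, hcard, nsmul_eq_mul, ← Finset.mul_sum,
      Finset.sum_erase_eq_sub (Finset.mem_univ k), Finset.sum_erase_eq_sub (Finset.mem_univ k)]
  calc ∑ k, ∑ j ∈ Finset.univ.erase k, x k ^ 3 * (x k - x j)⁻¹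
      = ∑ k, ∑ j ∈ Finset.univ.erase k, ((x k ^ 2 + x k * x j + x j ^ 2) / 2 + (x k ^ 3 + x j ^ 3) / (2 * (x k - x j))) := Finset.sum_congr rfl fun k _ => Finset.sum_congr rfl (hsplit k)
    _ = ∑ k : Fin (t + 1), (((t : ℝ) * x k ^ 2 + x k * (∑ j, x j - x k) + (∑ j, x j ^ 2 - x k ^ 2)) / 2 + ∑ j ∈ Finset.univ.erase k, (x k ^ 3 + x j ^ 3) / (2 * (x k - x j))) :=
        Finset.sum_congr rfl fun k _ => by rw [Finset.sum_add_distrib, hlin]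
    _ = ((2 * (t : ℝ) - 1) * ∑ k, x k ^ 2 + (∑ k, x k) ^ 2) / 2 := by
        rw [Finset.sum_add_distrib, hanti, add_zero, ← Finset.sum_div]
        congr 1
        have e : ∀ k : Fin (t + 1), (t : ℝ) * x k ^ 2 + x k * (∑ j, x j - x k) + (∑ j, x j ^ 2 - x k ^ 2) = ((t : ℝ) - 2) * x k ^ 2 + (∑ j, x j) * x k + ∑ j, x j ^ 2 := fun k => by ring
        rw [Finset.sum_congr rfl fun k _ => e k, Finset.sum_add_distrib, Finset.sum_add_distrib, ← Finset.mul_sum, ← Finset.mul_sum, Finset.sum_const, Finset.card_univ, Fintype.card_fin,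
          nsmul_eq_mul]
        push_cast; ring

/-- **HERMITE: `Σ_k x_k⁴ = t(t+1)(2t−1)`** for the zeros of `He_{t+1}` (from `S_k = x_k∕2`, `Σ x = 0`, `Σ x² = t(t+1)`). [Ahmed et al. 1979; this file, §1164] -/
theorem hermite_zeros_fourth_moment {t : ℕ} {x : Fin (t + 1) → ℝ} (hx : StrictMono x)
    (hxq : (Polynomial.hermite (t + 1)).map (Int.castRingHom ℝ) = ∏ k, (Polynomial.X - C (x k))) (hsum : ∑ k, x k = 0) (hsq : ∑ k, x k ^ 2 = (t : ℝ) * ((t : ℝ) + 1)) :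
    ∑ k, x k ^ 4 = (t : ℝ) * ((t : ℝ) + 1) * (2 * (t : ℝ) - 1) := by
  have hel := fun k => hermite_zeros_electrostatic hx hxq k
  have hcube := sum_sum_erase_cube_mul_inv_sub hx.injective
  simp_rw [← Finset.mul_sum] at hcube
  rw [Finset.sum_congr rfl fun k _ => by rw [hel k], hsum, hsq] at hcube
  have h4 : ∑ k, x k ^ 3 * (x k / 2) = (∑ k, x k ^ 4) / 2 := by rw [Finset.sum_div]; exact Finset.sum_congr rfl fun k _ => by ring
  rw [h4] at hcube
  linarith

/-- **LAGUERRE: `Σ_k x_k³ = (2t + α) Σ_k x_k² + (Σ_k x_k)²`** for the zeros of `L^{(α)}_{t+1}` (from `2 x_k S_k = x_k − α − 1`); with N376 ∕ N394: `S₁ = (t+1)(t+1+α)`, `S₂ = (2t+1+α) S₁`.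
[Ahmed et al. 1979; this file, §1164] -/
theorem laguerre_zeros_third_moment {L : ℕ → ℝ[X]} {a b : ℕ → ℝ} {α : ℝ} (hL0 : L 0 = 1) (hL1 : L 1 = Polynomial.X - C (a 0))
    (hLrec : ∀ n, L (n + 2) = (Polynomial.X - C (a (n + 1))) * L (n + 1) - C (b (n + 1)) * L n) (ha : ∀ n, a n = 2 * n + 1 + α)
    (hb : ∀ n, b (n + 1) = ((n : ℝ) + 1) * ((n : ℝ) + 1 + α)) {t : ℕ} {x : Fin (t + 1) → ℝ} (hx : StrictMono x)
    (hxq : L (t + 1) = ∏ k, (Polynomial.X - C (x k))) (hpos : ∀ k, 0 < x k) :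
    ∑ k, x k ^ 3 = (2 * (t : ℝ) + α) * ∑ k, x k ^ 2 + (∑ k, x k) ^ 2 := by
  have hel := fun k => laguerre_zeros_electrostatic hL0 hL1 hLrec ha hb hx hxq hpos k
  have hcube := sum_sum_erase_cube_mul_inv_sub hx.injective
  simp_rw [← Finset.mul_sum] at hcube
  rw [Finset.sum_congr rfl fun k _ => by rw [hel k]] at hcube
  have h3 : ∑ k, x k ^ 3 * ((x k - α - 1) / (2 * x k)) = (∑ k, x k ^ 3 - (α + 1) * ∑ k, x k ^ 2) / 2 := by
    rw [Finset.mul_sum, ← Finset.sum_sub_distrib, Finset.sum_div]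
    exact Finset.sum_congr rfl fun k _ => by have := (hpos k).ne'; field_simp; ring
  rw [h3] at hcube
  linarith

end Summit.Ventures.HSemireg.Wedge.HankelOuter
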